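import Literature.AnabelianGeometry.AbsoluteAnabelian.AbsTopIII.KummerFaithfulPurelyTranscendentalAbelianProofs
import Literature.AnabelianGeometry.AbsoluteAnabelian.AbsTopIII.KummerFaithfulPurelyTranscendentalProofs
import Literature.AnabelianGeometry.AbsoluteAnabelian.AbsTopIII.KummerFaithfulPurelyTranscendentalDecompositionProofs
import Literature.AnabelianGeometry.AbsoluteAnabelian.AbsTopIII.KummerFaithfulSubpadicHolds
import Literature.AlgebraicGeometry.Motives.AbelianVarietyFGSubfieldDescent
import Mathlib.FieldTheory.IntermediateField.Adjoin.Algebra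
import HarnessLib

/-!
# [AbsTopIII] Rmk. 1.5.4 (iii) PROVED: `ℚ_p(x_i)_{i ∈ I}` (`I` infinite) is Kummer-faithful and not
# sub-`p`-adic (FACT-LIST row F-0371)

Proof-only companion (no new definitions) to `AbsTopIII/KummerFaithful.lean` (S. Mochizuki, *Topics in
Absolute Anabelian Geometry III*, §1, Rmk. 1.5.4 (iii), manuscript p. 34, lit key
`paper:url-5493eb38cbb7`): "if, for instance, `I` is an infinite set, then the field
`k := ℚ_p(x_i)_{i ∈ I}` [which is not a finitely generated extension of `ℚ_p`] constitutes an example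
of a Kummer-faithful field which is not sub-`p`-adic."  The printed argument for Kummer-faithfulness
(p. 34, l. 9–19) runs: a point `f` in the kernel of the Kummer map of a semi-abelian variety `A / k_H`
lives, after descending `A` to `A′` over `k′_H ⊇ ℚ_p(x_i)_{i ∈ I′}` (`I′` finite) with
`k_H = k′_H(x_i)_{i ∈ I″}`, in `A′(k′_H)`, "since `k′_H` is algebraically closed in `k_H` [...] all
roots of `f` defined over `k_H` are in fact defined over `k′_H`", contradicting the Kummer-faithfulness
of the sub-`p`-adic field `k′_H`.  The tree's route below is this argument for ABELIAN varieties, with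
"all roots are defined over `k′_H`" replaced by the stronger "an abelian variety acquires no new points
in the purely transcendental extension `k′_H(x_i)_{i ∈ I″}`" (Milne, *Abelian Varieties*, §3 Cor. 3.8).

This file CLOSES the named fact `Rmk_1_5_4_iii` (**`Rmk_1_5_4_iii_holds`**).  The torus clause and
"not sub-`p`-adic" were proved earlier (`Rmk_1_5_4_iii_torally`, `not_isSubpadic_fractionRing_mvPolynomial`,
abc-iut-L4-d2); the tree reduced the fact to the ABELIAN-VARIETY clause of Def. 1.5 (a) for the finite
extensions `k'` of `ℚ_p(x_I)` (`Rmk_1_5_4_iii_of_abelianVariety_clause`), which is assembled here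
along the printed argument, junction by junction (cell abc-iut, seats f-072 / f-078 / f-080 and the
F-0369 team):

* K-dec (`exists_fg_intermediateField_purelyTranscendental`,
  `KummerFaithfulPurelyTranscendentalDecompositionProofs`; the construction of the torus file /
  `KummerFaithfulPurelyTranscendentalSubfieldsProofs` with its purely transcendental structure exported): `k' ⊇ E_J ⊇` any given finite set, `E_J` finitely generated over `ℚ_p`,
  `k' = E_J(z_{I∖J})` with `z_{I∖J}` algebraically independent over `E_J`;
* K0 (`AbelianVariety.exists_finset_intermediateField_descent`, `Motives/AbelianVarietyFGSubfieldDescent`,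
  abc-iut-f-072; EGA IV₃ 8.8.2): an abelian variety `A / k'` is `A₁ ⊗_{E_J} k'` for an abelian variety
  `A₁` over any intermediate field `E_J` containing a certain finite set;
* K-∞ (`divisibleElementsTrivial_points_of_iso_baseChange`, `KummerFaithfulPurelyTranscendentalAbelianProofs`
  with `Motives/AbelianVarietyPurelyTranscendentalPoints(AnyIndex)`, abc-iut-f-078; Milne, *Abelian
  Varieties*, §3 Cor. 3.8): `A(k') ≅ A₁(k') = A₁(E_J)`, an abelian variety acquires no new points in a
  purely transcendental extension;
* F-0369 (`divisibleElementsTrivial_points_of_fg_padic`, `KummerFaithfulSubpadicHolds`, abc-iut-f-080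
  on the route of abc-iut-f-083/f-072/f-070: Rmk. 1.5.4 (i)–(ii)): `⋂_N N·A₁(E_J) = 0` since `E_J` is
  finitely generated over `ℚ_p`.

HONEST FRAMING: OUR kernel check of a refereed remark with the tree's typing of `IsKummerFaithful`
(tori and abelian varieties; implied by the printed definition); classical; nothing here bears on
[IUTchIII] Cor. 3.12.
-/

noncomputable section

open scoped Classical
open CategoryTheory

namespace Literature.AnabelianGeometry.AbsoluteAnabelian.AbsTopIII

open Literature.AlgebraicGeometry.Motives

universe u

/-! ### Def. 1.5 (a) along an `E_J`-isomorphism `Frac E_J[x_S] ≅ k'` -/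

/-- **Condition (a) of Def. 1.5 for every abelian variety `A / K` which is the base change of an
abelian variety `A₀ / k₀` with `⋂_N N·A₀(k₀) = 0`, where `K ≅ Frac k₀[x_S]` over `k₀`** — the
`AlgEquiv` form of `divisibleElementsTrivial_points_of_iso_baseChange` (same proof through
`AbelianVariety.algPoints_const_of_algEquiv_mvPolynomial_index`). [cite: MochizukiAbsTopIII2015, Rmk 1.5.4 (iii) p.34] -/
theorem divisibleElementsTrivial_points_of_iso_baseChange_of_algEquiv
    {k₀ : Type u} [Field k₀] [Infinite k₀] (K : Type u) [Field K] [Algebra k₀ K] (S : Type u)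
    (eK : FractionRing (MvPolynomial S k₀) ≃ₐ[k₀] K)
    (A : AbelianVariety K) (A₀ : AbelianVariety k₀) (e : A.X ≅ (A₀.baseChange K).X) [IsMonHom e.hom]
    (hA₀ : DivisibleElementsTrivial (A₀.Points k₀)) :
    DivisibleElementsTrivial (A.Points K) := by
  -- `A₀(k₀) → A₀(K)` is a bijective group homomorphism
  let φ : A₀.Points k₀ →* A₀.Points K :=
    MonoidHom.mk' (fun P => AlgPoints.specOverMapOfAlgHom (Algebra.ofId k₀ K) ≫ P)
      fun P Q => MonObj.comp_mul _ P Q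
  have hφ : Function.Bijective φ := by
    refine ⟨A₀.specOverMap_comp_injective K, fun x => ?_⟩
    obtain ⟨P₀, hP₀⟩ := A₀.algPoints_const_of_algEquiv_mvPolynomial_index S eK x
    exact ⟨P₀, hP₀.symm⟩
  have hbc : DivisibleElementsTrivial ((A₀.baseChange K).Points K) :=
    DivisibleElementsTrivial.of_mulEquiv
      ((MulEquiv.ofBijective φ hφ).trans (A₀.pointsMulEquiv K)).symm hA₀
  -- transport along `e`
  let ψ : A.Points K →* (A₀.baseChange K).Points K :=
    MonoidHom.mk' (fun P => P ≫ e.hom) fun P Q => MonObj.mul_comp P Q e.hom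
  have hψ : Function.Injective ψ := fun P Q h => by
    have h' : (P ≫ e.hom) ≫ e.inv = (Q ≫ e.hom) ≫ e.inv := congrArg (fun R => R ≫ e.inv) h
    simpa only [Category.assoc, Iso.hom_inv_id, Category.comp_id] using h'
  refine ⟨fun x hx => hψ ?_⟩
  rw [map_one]
  refine hbc.eq_one_of_forall_exists_pow (ψ x) fun n hn => ?_
  obtain ⟨y, hy⟩ := hx n hn
  exact ⟨ψ y, by rw [← map_pow, hy]⟩

/-! ### The abelian-variety clause and the named fact -/

/-- **The abelian-variety clause of Def. 1.5 for the finite extensions of `ℚ_p(x_i)_{i ∈ I}`**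
(`I` any index type): for `k'` finite over `K_I = Frac ℚ_p[x_I]` and every abelian variety `A / k'`,
`⋂_N N·A(k') = 0`.  Proof (the route of p. 34, l. 9–19, for abelian varieties): `k' = E_J(z_{I∖J})` with
`E_J` finitely generated over `ℚ_p` and large enough that `A = A₁ ⊗_{E_J} k'` (K0, K-dec); then
`A(k') ≅ A₁(k') = A₁(E_J)` (K-∞) and `⋂_N N·A₁(E_J) = 0` by Rmk. 1.5.4 (i)–(ii) for the finitely
generated extension `E_J` of `ℚ_p` (`divisibleElementsTrivial_points_of_fg_padic`).
[cite: MochizukiAbsTopIII2015, Rmk 1.5.4 (iii) p.34] -/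
theorem divisibleElementsTrivial_points_of_finite_fractionRing_mvPolynomial_padic
    (p : ℕ) [Fact p.Prime] (I : Type) (k' : Type) [Field k']
    [Algebra (FractionRing (MvPolynomial I ℚ_[p])) k']
    (hfin : Module.Finite (FractionRing (MvPolynomial I ℚ_[p])) k') (A : AbelianVariety k') :
    DivisibleElementsTrivial (A.Points k') := by
  classical
  haveI := hfin
  set KI := FractionRing (MvPolynomial I ℚ_[p]) with hKI
  letI : Algebra ℚ_[p] k' := ((algebraMap KI k').comp (algebraMap ℚ_[p] KI)).toAlgebra
  haveI : IsScalarTower ℚ_[p] KI k' := IsScalarTower.of_algebraMap_eq (fun _ => rfl)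
  haveI : CharZero k' := charZero_of_injective_algebraMap (algebraMap ℚ_[p] k').injective
  -- the variables, viewed in `k'`
  let θ : MvPolynomial I ℚ_[p] →ₐ[ℚ_[p]] k' :=
    (IsScalarTower.toAlgHom ℚ_[p] KI k').comp (IsScalarTower.toAlgHom ℚ_[p] (MvPolynomial I ℚ_[p]) KI)
  have hθapply : ∀ a, θ a = algebraMap KI k' (algebraMap (MvPolynomial I ℚ_[p]) KI a) := fun _ => rfl
  have hθ : Function.Injective θ := by
    intro a c h
    rw [hθapply, hθapply] at h
    exact IsFractionRing.injective (MvPolynomial I ℚ_[p]) KI ((algebraMap KI k').injective h)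
  let z : I → k' := fun i => θ (MvPolynomial.X i)
  have haeval : MvPolynomial.aeval z = θ := MvPolynomial.algHom_ext fun i => by simp [z]
  have hz : AlgebraicIndependent ℚ_[p] z := by
    rw [algebraicIndependent_iff_injective_aeval, haeval]
    exact hθ
  -- `k'` is finite over `ℚ_p(z_I) ⊇ image of K_I`
  have hθmem : ∀ a : MvPolynomial I ℚ_[p], θ a ∈ IntermediateField.adjoin ℚ_[p] (Set.range z) := by
    intro a
    have h1 : θ a ∈ Algebra.adjoin ℚ_[p] (Set.range z) := by
      rw [Algebra.adjoin_range_eq_range_aeval, haeval]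
      exact ⟨a, rfl⟩
    exact IntermediateField.algebra_adjoin_le_adjoin ℚ_[p] _ h1
  have hKmem : ∀ x : KI, algebraMap KI k' x ∈ IntermediateField.adjoin ℚ_[p] (Set.range z) := by
    intro x
    obtain ⟨a, c, -, rfl⟩ := IsFractionRing.div_surjective (A := MvPolynomial I ℚ_[p]) x
    rw [map_div₀, ← hθapply, ← hθapply]
    exact div_mem (hθmem a) (hθmem c)
  letI : Algebra KI (IntermediateField.adjoin ℚ_[p] (Set.range z)) :=
    ((algebraMap KI k').codRestrict (IntermediateField.adjoin ℚ_[p] (Set.range z)) hKmem).toAlgebra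
  haveI : IsScalarTower KI (IntermediateField.adjoin ℚ_[p] (Set.range z)) k' :=
    IsScalarTower.of_algebraMap_eq (fun _ => rfl)
  haveI : Module.Finite (IntermediateField.adjoin ℚ_[p] (Set.range z)) k' :=
    Module.Finite.of_restrictScalars_finite KI _ k'
  -- K0: `A` descends to every intermediate field containing a finite set `s`
  obtain ⟨s, hs⟩ := AbelianVariety.exists_finset_intermediateField_descent (F := ℚ_[p]) A
  -- K-dec: `E_J ⊇ s` finitely generated with `k' = E_J(w)` purely transcendental
  obtain ⟨s', EJ, -, hsEJ, hEJfg, hw, htop⟩ :=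
    exists_fg_intermediateField_purelyTranscendental (k := ℚ_[p]) z hz s
  obtain ⟨A₁, ⟨φ⟩⟩ := hs EJ hsEJ
  -- `Frac E_J[x_S] ≅ k'` over `E_J`, `S = I ∖ s'`
  let eK : FractionRing (MvPolynomial (↥s'ᶜ) EJ) ≃ₐ[EJ] k' :=
    hw.aevalEquivField.trans ((IntermediateField.equivOfEq htop).trans IntermediateField.topEquiv)
  -- F-0369: `⋂_N N·A₁(E_J) = 0`, `E_J` being finitely generated over `ℚ_p`
  haveI : Algebra.EssFiniteType ℚ_[p] EJ := IntermediateField.essFiniteType_iff.mpr hEJfg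
  have hA₁ : DivisibleElementsTrivial (A₁.Points EJ) :=
    divisibleElementsTrivial_points_of_fg_padic p EJ (IntermediateField.fg_top ℚ_[p] EJ) A₁
  -- `E_J` is infinite (characteristic zero)
  haveI : CharZero EJ := charZero_of_injective_algebraMap (algebraMap ℚ_[p] EJ).injective
  haveI : Infinite EJ := Infinite.of_injective _ (algebraMap ℚ EJ).injective
  -- transport along the isomorphism of abelian varieties `φ : A₁ ⊗ k' ≅ A`
  let e : A.X ≅ (A₁.baseChange k').X := AbelianVariety.overIsoOfIso φ.symm
  haveI : IsMonHom e.hom := inferInstanceAs (IsMonHom φ.inv.hom.hom.hom)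
  exact divisibleElementsTrivial_points_of_iso_baseChange_of_algEquiv k' (↥s'ᶜ) eK A A₁ e hA₁

/-- **[AbsTopIII] Rmk. 1.5.4 (iii) (FACT-LIST row F-0371), PROVED**: for every prime `p` and every
infinite set `I`, the field `ℚ_p(x_i)_{i ∈ I}` is Kummer-faithful (tree predicate: tori and abelian
varieties) and is not sub-`p`-adic. [cite: MochizukiAbsTopIII2015, Rmk 1.5.4 (iii) p.34] -/
theorem Rmk_1_5_4_iii_holds : Rmk_1_5_4_iii :=
  Rmk_1_5_4_iii_of_abelianVariety_clause fun p _ I _ k' _ _ hfin A =>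
    divisibleElementsTrivial_points_of_finite_fractionRing_mvPolynomial_padic p I k' hfin A

/-- Instance form: `ℚ_p(x_i)_{i ∈ I}` is Kummer-faithful for EVERY index set `I` (finite or
infinite). [cite: MochizukiAbsTopIII2015, Rmk 1.5.4 (iii) p.34] -/
theorem isKummerFaithful_fractionRing_mvPolynomial_padic (p : ℕ) [Fact p.Prime] (I : Type) :
    IsKummerFaithful (FractionRing (MvPolynomial I ℚ_[p])) :=
  ⟨Rmk_1_5_4_iii_torally p I, fun k' _ _ hfin A =>
    divisibleElementsTrivial_points_of_finite_fractionRing_mvPolynomial_padic p I k' hfin A⟩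

end Literature.AnabelianGeometry.AbsoluteAnabelian.AbsTopIII
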